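import Summits.AtomisticToContinuum.HydrodynamicLimit.Theorems.EnskogAdjointDualityDualityReductionMaxwellian
import HarnessLib

/-!
# EnskogAdjointDuality / DualityReduction — helper 8: the Euler (local-Maxwellian) side of the
# duality identity

Support lemmas for `Summit.AtomisticToContinuum.HydrodynamicLimit.Theses.EnskogAdjointDuality.DualityReduction`
(stmt-AtomisticToContinuum-11590). In the duality bookkeeping the Enskog defect of the Euler
local Maxwellian `Res_N = ∫∫f_tφ_t − ∫∫f_0φ_0 − I₃`, `I₃ = ∫₀ᵗ∫∫ f (Dφ + ½Lφ)`, and the centring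
`½ I₂ = ½∫₀ᵗ∫∫ f Lφ` of the collision residual combine into `I₃ + ½ I₂ = ∫₀ᵗ∫∫ f (D + L)φ`, which is
`O(η_N)` by the defect bound `|(D+L)φ| ≤ η_N (1+|v|²)`. Making this rigorous needs every iterated
Bochner integral involved to be a genuine integral: this file proves the integrability at the
`v`-, `x`- and `s`-levels (Gaussian domination, helper 4; measurability from helper 7) and the
resulting bound

* `abs_I3_add_half_I2_le` — `|I₃ + ½ I₂| ≤ η · t · R (2 + U² + 3Θ)`.

References: H. Spohn, *Large Scale Dynamics of Interacting Particles* (1991), Part I §3.3;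
M. Pulvirenti, S. Simonella, arXiv:1504.03215, §2 [PulvirentiSimonella2016].
-/

noncomputable section

open MeasureTheory Set Filter Topology Function
open scoped ENNReal BigOperators InnerProductSpace

namespace Summit.AtomisticToContinuum.HydrodynamicLimit.Theorems

open Literature.Analysis.FluidPDE Literature.MathematicalPhysics.KineticTheory

section FSide

variable {ρ θ : ℝ → T3 → ℝ} {u : ℝ → T3 → V3} {t R U Θ CG : ℝ}
  {f : ℝ → T3 → V3 → ℝ}

/-- `v`-level: pairing `f_s(x, ·) = ρ M_{1,θ,u}` with a measurable kernel `|h| ≤ K(1+|v|²)²` is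
integrable, with `|∫ f h| ≤ R K C_G`. [folklore] -/
theorem integrable_f_mul_of_abs_le
    (hρ : ∀ s ∈ Icc 0 t, ∀ x, 0 ≤ ρ s x ∧ ρ s x ≤ R) (hu : ∀ s ∈ Icc 0 t, ∀ x, ‖u s x‖ ≤ U)
    (hθ : ∀ s ∈ Icc 0 t, ∀ x, 0 < θ s x ∧ θ s x ≤ Θ)
    (hCG : ∀ (u' : V3) (θ' : ℝ), ‖u'‖ ≤ U → 0 < θ' → θ' ≤ Θ →
      ∫ v, (1 + ‖v‖ ^ 2) ^ 2 ∂gaussMeasure u' θ' ≤ CG)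
    (hf : ∀ s x v, f s x v = ρ s x * localMaxwellian 1 (θ s x) (u s x) v)
    {s : ℝ} (hs : s ∈ Icc 0 t) (x : T3) {h : V3 → ℝ} (hm : Measurable h) {K : ℝ}
    (hK : ∀ v, |h v| ≤ K * (1 + ‖v‖ ^ 2) ^ 2) :
    Integrable (fun v => f s x v * h v) ∧ |∫ v, f s x v * h v| ≤ R * (K * CG) := by
  have hfun : (fun v => f s x v * h v) = fun v => ρ s x * (localMaxwellian 1 (θ s x) (u s x) v * h v) := by
    funext v; rw [hf]; ring
  rw [hfun]
  have hθx := hθ s hs x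
  have hρx := hρ s hs x
  refine ⟨(integrable_localMaxwellian_mul_of_abs_le hθx.1 _ hm.aestronglyMeasurable hK).const_mul _, ?_⟩
  rw [integral_const_mul, abs_mul, abs_of_nonneg hρx.1]
  have hK0 : 0 ≤ K := by
    have := (abs_nonneg _).trans (hK 0)
    simpa using this
  refine mul_le_mul hρx.2 ((abs_integral_localMaxwellian_mul_le hθx.1 _ hK).trans ?_)
    (abs_nonneg _) ((hρx.1).trans hρx.2)
  exact mul_le_mul_of_nonneg_left (hCG _ _ (hu s hs x) hθx.1 hθx.2) hK0

/-- `x`-level: for a measurable kernel `H` on `𝕋³ × ℝ³` with `|H(x, v)| ≤ K(1+|v|²)²` and a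
measurable slice `(x, v) ↦ f_s(x, v)`, the map `x ↦ ∫ f_s H(x, ·) dv` is integrable on `𝕋³` and
`|∫∫ f_s H| ≤ R K C_G`. [folklore] -/
theorem integrable_x_f_mul_of_abs_le
    (hρ : ∀ s ∈ Icc 0 t, ∀ x, 0 ≤ ρ s x ∧ ρ s x ≤ R) (hu : ∀ s ∈ Icc 0 t, ∀ x, ‖u s x‖ ≤ U)
    (hθ : ∀ s ∈ Icc 0 t, ∀ x, 0 < θ s x ∧ θ s x ≤ Θ)
    (hCG : ∀ (u' : V3) (θ' : ℝ), ‖u'‖ ≤ U → 0 < θ' → θ' ≤ Θ →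
      ∫ v, (1 + ‖v‖ ^ 2) ^ 2 ∂gaussMeasure u' θ' ≤ CG)
    (hf : ∀ s x v, f s x v = ρ s x * localMaxwellian 1 (θ s x) (u s x) v)
    {s : ℝ} (hs : s ∈ Icc 0 t) (hfm : Measurable fun q : T3 × V3 => f s q.1 q.2)
    {H : T3 → V3 → ℝ} (hHm : Measurable fun q : T3 × V3 => H q.1 q.2) {K : ℝ}
    (hK : ∀ x v, |H x v| ≤ K * (1 + ‖v‖ ^ 2) ^ 2) :
    Integrable (fun x => ∫ v, f s x v * H x v) ∧
      |∫ x, ∫ v, f s x v * H x v| ≤ R * (K * CG) := by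
  have hsm : StronglyMeasurable fun q : T3 × V3 => f s q.1 q.2 * H q.1 q.2 :=
    (hfm.mul hHm).stronglyMeasurable
  have hint : StronglyMeasurable fun x : T3 => ∫ v, f s x v * H x v :=
    hsm.integral_prod_right'
  have hbd : ∀ x, |∫ v, f s x v * H x v| ≤ R * (K * CG) := fun x =>
    (integrable_f_mul_of_abs_le hρ hu hθ hCG hf hs x
      (hHm.comp (measurable_const.prodMk measurable_id)) (fun v => hK x v)).2
  refine ⟨?_, ?_⟩
  · exact (integrable_const (R * (K * CG))).mono' hint.aestronglyMeasurable
      (Eventually.of_forall fun x => by rw [Real.norm_eq_abs]; exact hbd x)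
  · have h := norm_integral_le_of_norm_le (integrable_const (R * (K * CG)))
      (Eventually.of_forall fun x => by rw [Real.norm_eq_abs]; exact hbd x)
      (f := fun x : T3 => ∫ v, f s x v * H x v) (μ := volume)
    rw [integral_const, smul_eq_mul, probReal_univ, one_mul, Real.norm_eq_abs] at h
    exact h

/-- `s`-level: if `Φf(s, x, v) = f_s(x, v)` on `[0, t]` for a measurable `Φf` on `ℝ × 𝕋³ × ℝ³`
(e.g. the time-frozen profiles) and the measurable kernel `H` satisfies `|H(s, x, v)| ≤ K(1+|v|²)²`
for `s ∈ S`, `S ⊆ [0, t]` of full measure in `[0, t]`, then `s ↦ ∫∫ f_s H(s, ·, ·)` is integrable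
on `[0, t]`, bounded by `R K C_G` on `S`. [folklore] -/
theorem integrableOn_s_f_mul_of_abs_le
    (hρ : ∀ s ∈ Icc 0 t, ∀ x, 0 ≤ ρ s x ∧ ρ s x ≤ R) (hu : ∀ s ∈ Icc 0 t, ∀ x, ‖u s x‖ ≤ U)
    (hθ : ∀ s ∈ Icc 0 t, ∀ x, 0 < θ s x ∧ θ s x ≤ Θ)
    (hCG : ∀ (u' : V3) (θ' : ℝ), ‖u'‖ ≤ U → 0 < θ' → θ' ≤ Θ →
      ∫ v, (1 + ‖v‖ ^ 2) ^ 2 ∂gaussMeasure u' θ' ≤ CG)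
    (hf : ∀ s x v, f s x v = ρ s x * localMaxwellian 1 (θ s x) (u s x) v)
    {Φf : ℝ × T3 × V3 → ℝ} (hΦm : Measurable Φf) (hΦf : ∀ s ∈ Icc 0 t, ∀ x v, Φf (s, x, v) = f s x v)
    {H : ℝ → T3 → V3 → ℝ} (hHm : Measurable fun p : ℝ × T3 × V3 => H p.1 p.2.1 p.2.2)
    {S : Set ℝ} (hSsub : S ⊆ Icc 0 t)
    (hSae : ∀ᵐ s ∂(volume.restrict (Icc 0 t)), s ∈ S) {K : ℝ}
    (hK : ∀ s ∈ S, ∀ x v, |H s x v| ≤ K * (1 + ‖v‖ ^ 2) ^ 2) :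
    IntegrableOn (fun s => ∫ x, ∫ v, f s x v * H s x v) (Icc 0 t) ∧
      ∀ s ∈ S, |∫ x, ∫ v, f s x v * H s x v| ≤ R * (K * CG) := by
  -- measurability through the frozen modification
  have hsm : StronglyMeasurable fun q : (ℝ × T3) × V3 =>
      Φf (q.1.1, q.1.2, q.2) * H q.1.1 q.1.2 q.2 := by
    have hre : Measurable fun q : (ℝ × T3) × V3 => ((q.1.1, q.1.2, q.2) : ℝ × T3 × V3) := by
      fun_prop
    exact ((hΦm.comp hre).mul (hHm.comp hre)).stronglyMeasurable
  have h1 : StronglyMeasurable fun q : ℝ × T3 => ∫ v, Φf (q.1, q.2, v) * H q.1 q.2 v :=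
    hsm.integral_prod_right'
  have h2 : StronglyMeasurable fun s : ℝ => ∫ x, ∫ v, Φf (s, x, v) * H s x v :=
    h1.integral_prod_right'
  have hbd : ∀ s ∈ S, |∫ x, ∫ v, f s x v * H s x v| ≤ R * (K * CG) := by
    intro s hsS
    have hs : s ∈ Icc 0 t := hSsub hsS
    have hfm : Measurable fun q : T3 × V3 => f s q.1 q.2 := by
      have : (fun q : T3 × V3 => f s q.1 q.2) = fun q => Φf (s, q.1, q.2) := by
        funext q; rw [hΦf s hs]
      rw [this]
      exact hΦm.comp (measurable_const.prodMk measurable_id)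
    exact (integrable_x_f_mul_of_abs_le hρ hu hθ hCG hf hs hfm (H := H s)
      (hHm.comp (measurable_const.prodMk measurable_id)) (fun x v => hK s hsS x v)).2
  refine ⟨?_, hbd⟩
  have hae : (fun s => ∫ x, ∫ v, f s x v * H s x v) =ᵐ[volume.restrict (Icc 0 t)]
      fun s => ∫ x, ∫ v, Φf (s, x, v) * H s x v := by
    filter_upwards [ae_restrict_mem measurableSet_Icc] with s hs
    simp_rw [hΦf s hs]
  refine Integrable.congr ?_ hae.symm
  refine (integrable_const (R * (K * CG))).mono' h2.aestronglyMeasurable ?_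
  filter_upwards [hSae, ae_restrict_mem measurableSet_Icc] with s hsS hs
  rw [Real.norm_eq_abs]
  have : (∫ x, ∫ v, Φf (s, x, v) * H s x v) = ∫ x, ∫ v, f s x v * H s x v := by
    simp_rw [hΦf s hs]
  rw [this]
  exact hbd s hsS

/-- **The Euler side of the duality identity.** With `f_s = ρ_s M_{1,θ_s,u_s}` (profiles bounded on
`[0, t] × 𝕋³`: `0 ≤ ρ ≤ R`, `‖u‖ ≤ U`, `0 < θ ≤ Θ`, and measurable after freezing time to `[0, t]`),
a kernel `L` with `|L| ≤ K(1+|v|²)²` on `[0, t]` and a kernel `D` with the DEFECT BOUND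
`|D + L| ≤ η(1+|v|²)` on `[0, t]` (both agreeing on the window with measurable functions of
`(s, x, v)`, `D` only on the open window), the combination appearing in `R_N − Res_N` satisfies
`|∫₀ᵗ∫∫ f (D + ½L) + ½ ∫₀ᵗ∫∫ f L| ≤ η · t · R · C_G` (`C_G` the uniform Gaussian bound of
`∫(1+|v|²)² dN(u, θ)`): all iterated integrals are genuine, the two combine into `∫₀ᵗ∫∫ f (D + L)`,
which is dominated by `η ∫∫ f (1+|v|²)²`. [cite: PulvirentiSimonella2016, §2] -/
theorem abs_I3_add_half_I2_le (ht : 0 < t)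
    (hρ : ∀ s ∈ Icc 0 t, ∀ x, 0 ≤ ρ s x ∧ ρ s x ≤ R) (hu : ∀ s ∈ Icc 0 t, ∀ x, ‖u s x‖ ≤ U)
    (hθ : ∀ s ∈ Icc 0 t, ∀ x, 0 < θ s x ∧ θ s x ≤ Θ)
    (hCG : ∀ (u' : V3) (θ' : ℝ), ‖u'‖ ≤ U → 0 < θ' → θ' ≤ Θ →
      ∫ v, (1 + ‖v‖ ^ 2) ^ 2 ∂gaussMeasure u' θ' ≤ CG)
    (hf : ∀ s x v, f s x v = ρ s x * localMaxwellian 1 (θ s x) (u s x) v)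
    {Φf : ℝ × T3 × V3 → ℝ} (hΦm : Measurable Φf) (hΦf : ∀ s ∈ Icc 0 t, ∀ x v, Φf (s, x, v) = f s x v)
    (D L : ℝ → T3 → V3 → ℝ) {Dm Lm : ℝ × T3 × V3 → ℝ} (hDm : Measurable Dm) (hLm : Measurable Lm)
    (hDD : ∀ s ∈ Ioo 0 t, ∀ x v, D s x v = Dm (s, x, v))
    (hLL : ∀ s ∈ Icc 0 t, ∀ x v, L s x v = Lm (s, x, v))
    {K η : ℝ} (hLb : ∀ s ∈ Icc 0 t, ∀ x v, |L s x v| ≤ K * (1 + ‖v‖ ^ 2) ^ 2) (hη : 0 ≤ η)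
    (hDL : ∀ s ∈ Icc 0 t, ∀ x v, |D s x v + L s x v| ≤ η * (1 + ‖v‖ ^ 2)) :
    |(∫ s in Icc 0 t, ∫ x, ∫ v, f s x v * (D s x v + (1 / 2 : ℝ) * L s x v)) +
        (1 / 2 : ℝ) * ∫ s in Icc 0 t, ∫ x, ∫ v, f s x v * L s x v| ≤
      η * (t * (R * CG)) := by
  -- the three kernels on `ℝ × 𝕋³ × ℝ³`, curried
  set HL : ℝ → T3 → V3 → ℝ := fun s x v => Lm (s, x, v) with hHL
  set HDL : ℝ → T3 → V3 → ℝ := fun s x v => Dm (s, x, v) + Lm (s, x, v) with hHDL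
  set H3 : ℝ → T3 → V3 → ℝ := fun s x v => Dm (s, x, v) + (1 / 2 : ℝ) * Lm (s, x, v) with hH3
  have hHLm : Measurable fun p : ℝ × T3 × V3 => HL p.1 p.2.1 p.2.2 := hLm
  have hHDLm : Measurable fun p : ℝ × T3 × V3 => HDL p.1 p.2.1 p.2.2 := hDm.add hLm
  have hH3m : Measurable fun p : ℝ × T3 × V3 => H3 p.1 p.2.1 p.2.2 := hDm.add (hLm.const_mul _)
  -- kernel bounds on the (open) window
  have hIoo : Ioo 0 t ⊆ Icc 0 t := Ioo_subset_Icc_self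
  have hbL : ∀ s ∈ Icc 0 t, ∀ x v, |HL s x v| ≤ K * (1 + ‖v‖ ^ 2) ^ 2 := fun s hs x v => by
    simp only [hHL]
    rw [← hLL s hs]
    exact hLb s hs x v
  have hone : ∀ v : V3, (1 + ‖v‖ ^ 2) ≤ (1 + ‖v‖ ^ 2) ^ 2 := fun v =>
    le_self_pow₀ (by nlinarith [sq_nonneg ‖v‖]) two_ne_zero
  have hbDL : ∀ s ∈ Ioo 0 t, ∀ x v, |HDL s x v| ≤ η * (1 + ‖v‖ ^ 2) ^ 2 := fun s hs x v => by
    simp only [hHDL]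
    rw [← hDD s hs, ← hLL s (hIoo hs)]
    exact (hDL s (hIoo hs) x v).trans (mul_le_mul_of_nonneg_left (hone v) hη)
  have hb3 : ∀ s ∈ Ioo 0 t, ∀ x v, |H3 s x v| ≤ (η + K / 2) * (1 + ‖v‖ ^ 2) ^ 2 := fun s hs x v => by
    have e : H3 s x v = HDL s x v - 1 / 2 * HL s x v := by
      simp only [hH3, hHDL, hHL]; ring
    rw [e]
    calc |HDL s x v - 1 / 2 * HL s x v| ≤ |HDL s x v| + |1 / 2 * HL s x v| := abs_sub _ _
      _ ≤ η * (1 + ‖v‖ ^ 2) ^ 2 + 1 / 2 * (K * (1 + ‖v‖ ^ 2) ^ 2) := by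
          have h1 := hbDL s hs x v
          have h2 : |1 / 2 * HL s x v| ≤ 1 / 2 * (K * (1 + ‖v‖ ^ 2) ^ 2) := by
            rw [abs_mul, abs_of_pos (by norm_num : (0 : ℝ) < 1 / 2)]
            exact mul_le_mul_of_nonneg_left (hbL s (hIoo hs) x v) (by norm_num)
          linarith
      _ = (η + K / 2) * (1 + ‖v‖ ^ 2) ^ 2 := by ring
  -- a.e. in `[0, t]` we are in the open window
  have hnull : volume ({0, t} : Set ℝ) = 0 := ((Set.finite_singleton t).insert 0).measure_zero _
  have hIooae : ∀ᵐ s ∂(volume : Measure ℝ), s ∈ Icc 0 t → s ∈ Ioo 0 t := by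
    filter_upwards [compl_mem_ae_iff.2 hnull] with s hs hsI
    simp only [mem_compl_iff, mem_insert_iff, mem_singleton_iff, not_or] at hs
    exact ⟨lt_of_le_of_ne hsI.1 (Ne.symm hs.1), lt_of_le_of_ne hsI.2 hs.2⟩
  have hSae : ∀ᵐ s ∂(volume.restrict (Icc 0 t)), s ∈ Ioo 0 t := by
    rw [ae_restrict_iff' measurableSet_Icc]
    exact hIooae
  -- slices of `f` are measurable on the window
  have hfslice : ∀ s ∈ Icc 0 t, Measurable fun q : T3 × V3 => f s q.1 q.2 := by
    intro s hs
    have : (fun q : T3 × V3 => f s q.1 q.2) = fun q => Φf (s, q.1, q.2) := by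
      funext q; rw [hΦf s hs]
    rw [this]
    exact hΦm.comp (measurable_const.prodMk measurable_id)
  -- `s`-level integrability of the three pieces
  obtain ⟨hIL, -⟩ := integrableOn_s_f_mul_of_abs_le hρ hu hθ hCG hf hΦm hΦf hHLm
    (S := Icc 0 t) Subset.rfl (ae_restrict_mem measurableSet_Icc) hbL
  obtain ⟨hI3, -⟩ := integrableOn_s_f_mul_of_abs_le hρ hu hθ hCG hf hΦm hΦf hH3m hIoo hSae hb3
  obtain ⟨-, hbdDL⟩ := integrableOn_s_f_mul_of_abs_le hρ hu hθ hCG hf hΦm hΦf hHDLm hIoo hSae hbDL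
  -- the `x`/`v`-level splitting, for `s` in the open window
  have hsplit : ∀ s ∈ Ioo 0 t,
      (∫ x, ∫ v, f s x v * H3 s x v) + (1 / 2 : ℝ) * (∫ x, ∫ v, f s x v * HL s x v) =
        ∫ x, ∫ v, f s x v * HDL s x v := by
    intro s hso
    have hs : s ∈ Icc 0 t := hIoo hso
    obtain ⟨hx3, -⟩ := integrable_x_f_mul_of_abs_le hρ hu hθ hCG hf hs (hfslice s hs) (H := H3 s)
      (hH3m.comp (measurable_const.prodMk measurable_id)) (fun x v => hb3 s hso x v)
    obtain ⟨hxL, -⟩ := integrable_x_f_mul_of_abs_le hρ hu hθ hCG hf hs (hfslice s hs) (H := HL s)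
      (hHLm.comp (measurable_const.prodMk measurable_id)) (fun x v => hbL s hs x v)
    rw [← integral_const_mul, ← integral_add hx3 (hxL.const_mul _)]
    refine integral_congr_ae (Eventually.of_forall fun x => ?_)
    obtain ⟨hv3, -⟩ := integrable_f_mul_of_abs_le hρ hu hθ hCG hf hs x (h := H3 s x)
      (hH3m.comp (measurable_const.prodMk (measurable_const.prodMk measurable_id)))
      (fun v => hb3 s hso x v)
    obtain ⟨hvL, -⟩ := integrable_f_mul_of_abs_le hρ hu hθ hCG hf hs x (h := HL s x)
      (hHLm.comp (measurable_const.prodMk (measurable_const.prodMk measurable_id)))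
      (fun v => hbL s hs x v)
    show (∫ v, f s x v * H3 s x v) + (1 / 2 : ℝ) * ∫ v, f s x v * HL s x v =
      ∫ v, f s x v * HDL s x v
    rw [← integral_const_mul, ← integral_add hv3 (hvL.const_mul _)]
    refine integral_congr_ae (Eventually.of_forall fun v => ?_)
    simp only [hH3, hHDL, hHL]
    ring
  -- identify the route's integrands with the kernels
  have hI3eq : (∫ s in Icc 0 t, ∫ x, ∫ v, f s x v * (D s x v + (1 / 2 : ℝ) * L s x v)) =
      ∫ s in Icc 0 t, ∫ x, ∫ v, f s x v * H3 s x v := by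
    refine setIntegral_congr_ae measurableSet_Icc ?_
    filter_upwards [hIooae] with s hs hsI
    have hso := hs hsI
    simp only [hH3, hDD s hso, hLL s hsI]
  have hILeq : (∫ s in Icc 0 t, ∫ x, ∫ v, f s x v * L s x v) =
      ∫ s in Icc 0 t, ∫ x, ∫ v, f s x v * HL s x v := by
    refine setIntegral_congr_fun measurableSet_Icc fun s hs => ?_
    simp only [hHL, hLL s hs]
  -- assemble
  calc |(∫ s in Icc 0 t, ∫ x, ∫ v, f s x v * (D s x v + (1 / 2 : ℝ) * L s x v)) +
        (1 / 2 : ℝ) * ∫ s in Icc 0 t, ∫ x, ∫ v, f s x v * L s x v|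
      = |∫ s in Icc 0 t, ((∫ x, ∫ v, f s x v * H3 s x v) +
          (1 / 2 : ℝ) * ∫ x, ∫ v, f s x v * HL s x v)| := by
        rw [hI3eq, hILeq, integral_add hI3 (hIL.const_mul _), integral_const_mul]
    _ = |∫ s in Icc 0 t, ∫ x, ∫ v, f s x v * HDL s x v| := by
        congr 1
        refine setIntegral_congr_ae measurableSet_Icc ?_
        filter_upwards [hIooae] with s hs hsI
        exact hsplit s (hs hsI)
    _ ≤ R * (η * CG) * (volume : Measure ℝ).real (Icc 0 t) := by
        have h := norm_setIntegral_le_of_norm_le_const_ae (μ := (volume : Measure ℝ))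
          (s := Icc 0 t) (f := fun s => ∫ x, ∫ v, f s x v * HDL s x v) (C := R * (η * CG))
          (by rw [Real.volume_Icc]; exact ENNReal.ofReal_lt_top) ?_
        · rwa [Real.norm_eq_abs] at h
        · filter_upwards [hSae] with s hso
          rw [Real.norm_eq_abs]
          exact hbdDL s hso
    _ = η * (t * (R * CG)) := by
        rw [Real.volume_real_Icc_of_le ht.le, sub_zero]
        ring

end FSide

end Summit.AtomisticToContinuum.HydrodynamicLimit.Theorems

end
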